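import Literature.AnabelianGeometry.SemiGraphs.FiniteEtaleCoveringCompConnected
import Literature.AnabelianGeometry.SemiGraphs.CoverticialRemark241OfLocalComp

/-!
# [SemiAnbd] Rmk. 2.4.1 along finite étale coverings (FACT-LIST F-1478) reduced to the tie WITHOUT
# connectedness hypotheses ([SemiAnbd] Def. 2.2 (i) p. 23, Rmk. 2.4.1 p. 26)

Mochizuki, *Semi-graphs of anabelioids*, Publ. RIMS **42** (2006) 221–322, §2, Remark 2.4.1 p. 26 and
Definition 2.2 (i) p. 23 [cite: MochizukiSemiAnbd2006, Rem. 2.4.1 p.26].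

PROOF-ONLY (abc-iut cell, layer L3; FACT-LIST row F-1478 `remark_2_4_1_covering`; Route W closing seat
abc-iut-w5-d041).  `FiniteEtaleCoveringCompConnected` proves that print's finite étale coverings of
CONNECTED semi-graphs of anabelioids compose; the only place where connectedness enters is abc-iut-f-161's
tie `Hom.tie_bijective` (hypotheses `ℋ.IsConnected`, `𝒦.IsConnected`).  This file isolates that residual
(GAP-LEDGER row G-w5d041-g4-1) as ONE theorem-shaped binder:

* `Hom.IsFiniteEtaleCoveringOf.comp_of_tieLabels` — the local clause of a composite from the tie LABELS
  (clauses 1–4 of `Hom.tie_bijective`, as a hypothesis on the given covering), no connectedness;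
* `remark_2_4_1_covering_of_tie` — **F-1478 holds as soon as the tie holds without connectedness
  hypotheses** (CONDITIONAL: the binder `htie` is exactly `Hom.tie_bijective` with `hℋ`, `h𝒦` dropped and
  clause 5 omitted; discharged today for connected middle and base graphs only).

Honest framing: conditional result; the binder is a theorem to be PROVED (not a new `Prop` definition,
not a published fact); nothing here takes a side on [IUTchIII] Cor. 3.12; typed ≠ proved.
-/

namespace Literature.AnabelianGeometry.SemiGraphs

namespace SemiGraphOfAnabelioids

open CategoryTheory CategoryTheory.Limits CategoryTheory.PreGaloisCategory
open Literature.AnabelianGeometry.Anabelioids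

universe v₁ u₁ u

-- Mathlib's `Over.pullback` / `Over.post` simp lemmas only fire under the pre-v4.2x defeq transparency
-- behaviour, exactly as in `Mathlib/CategoryTheory/Comma/Over/Pullback.lean` (also: `π₀Obj` coercions).
set_option backward.isDefEq.respectTransparency false

variable {𝒢 ℋ 𝒦 : SemiGraphOfAnabelioids.{v₁, u₁, u}}

/-- **The LOCAL clause of a composite from the tie labels** (no connectedness hypothesis): as
`Hom.IsFiniteEtaleCoveringOf.comp_of_connected`, with the conclusion of abc-iut-f-161's `Hom.tie_bijective`
(clauses 1–4) supplied as a hypothesis on `ψ`. [cite: MochizukiSemiAnbd2006, Def. 2.2(i) p.23] -/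
theorem Hom.IsFiniteEtaleCoveringOf.comp_of_tieLabels {φ : Hom 𝒢 ℋ} {ψ : Hom ℋ 𝒦} {B : ℋ.BObj}
    {A : 𝒦.BObj} (hφ : φ.IsFiniteEtaleCoveringOf B) (hψ : ψ.IsFiniteEtaleCoveringOf A)
    (hal : ψ.IsBranchAligned) (hva : ψ.IsVertexAligned)
    [HasBinaryProducts 𝒦.BObj] (αψ : Over A ⥤ ℋ.BObj) [αψ.IsEquivalence]
    (eψ : ψ.pullbackFunctor ≅ Over.star A ⋙ αψ)
    (htie : ∃ (O : ∀ w : ℋ.graph.Vertex, π₀Obj (A.S (ψ.base.vertexMap w)))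
      (OE : ∀ e' : ℋ.graph.Edge, π₀Obj (A.T (ψ.base.edgeMap e'))),
      Function.Bijective (fun w : ℋ.graph.Vertex =>
        (⟨ψ.base.vertexMap w, O w⟩ : Σ u, π₀Obj (A.S u))) ∧
      Function.Bijective (fun e' : ℋ.graph.Edge =>
        (⟨ψ.base.edgeMap e', OE e'⟩ : Σ e, π₀Obj (A.T e))) ∧
      (∀ (w : ℋ.graph.Vertex) (P : π₀Obj (A.S (ψ.base.vertexMap w))),
        P = O w ↔ ∃ k : (αψ.obj (Over.mk (𝟙 A))).S w ⟶
            (ψ.φV w).pullback.obj (P.1 : 𝒦.V (ψ.base.vertexMap w)),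
          k ≫ (ψ.φV w).pullback.map P.1.arrow =
            (αψ.map ((Over.forgetAdjStar A).unit.app (Over.mk (𝟙 A))) ≫ eψ.inv.app A).fS w) ∧
      (∀ (e' : ℋ.graph.Edge) (Q : π₀Obj (A.T (ψ.base.edgeMap e'))),
        Q = OE e' ↔ ∃ k : (αψ.obj (Over.mk (𝟙 A))).T e' ⟶
            (ψ.φE e' (ψ.base.edgeMap e') rfl).pullback.obj (Q.1 : 𝒦.E (ψ.base.edgeMap e')),
          k ≫ (ψ.φE e' (ψ.base.edgeMap e') rfl).pullback.map Q.1.arrow =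
            (αψ.map ((Over.forgetAdjStar A).unit.app (Over.mk (𝟙 A))) ≫ eψ.inv.app A).fT e')) :
    (φ.comp ψ).IsFiniteEtaleCoveringOf (αψ.inv.obj B).left := by
  have hφ' : φ.IsFiniteEtaleCoveringOf (αψ.obj (αψ.inv.obj B)) :=
    hφ.congr_iso (αψ.asEquivalence.counitIso.app B).symm
  obtain ⟨hψp, cV, cE₀, -, -, hVψ, hEψ, -⟩ := (show _ from hψ)
  choose αV hαV eV using hVψ
  have hE' : ∀ (e' : ℋ.graph.Edge) (f₀ : 𝒦.graph.Edge) (p : ψ.base.edgeMap e' = f₀),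
      ∃ (Q : π₀Obj (A.T f₀)) (α : Over (Q.1 : 𝒦.E f₀) ⥤ ℋ.E e'),
        α.IsEquivalence ∧ Nonempty ((ψ.φE e' f₀ p).pullback ≅ Over.star (Q.1 : 𝒦.E f₀) ⋙ α) := by
    intro e' f₀ p; subst p; exact ⟨cE₀ e', hEψ e'⟩
  choose cE αE hαE eE using hE'
  haveI : ∀ w, (αV w).IsEquivalence := hαV
  haveI : ∀ e' f₀ p, (αE e' f₀ p).IsEquivalence := hαE
  haveI : ∀ w, PreGaloisCategory.IsConnected ((cV w).1 : 𝒦.V (ψ.base.vertexMap w)) := fun w => (cV w).2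
  haveI : ∀ e' f₀ p, PreGaloisCategory.IsConnected ((cE e' f₀ p).1 : 𝒦.E f₀) :=
    fun e' f₀ p => (cE e' f₀ p).2
  have hT : ∀ e' f₀ p, IsTerminal ((αψ ⋙ ℋ.ρE e' ⋙ (αE e' f₀ p).inv).obj (Over.mk (𝟙 A))) :=
    fun e' f₀ p => by
      obtain ⟨-, -, hρE⟩ := ℋ.hasLimitsOfShape_bObj (J := Discrete PEmpty.{1})
      haveI := hρE e'
      haveI : PreservesLimitsOfShape (Discrete PEmpty.{1}) (αψ ⋙ ℋ.ρE e' ⋙ (αE e' f₀ p).inv) :=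
        inferInstance
      exact Over.mkIdTerminal.isTerminalObj _ _
  obtain ⟨O, OE, hO, hOE, hOc, hOEc⟩ := htie
  refine Hom.IsFiniteEtaleCoveringOf.comp_of_tie αψ eψ (αψ.inv.obj B) hψp cV αV (fun w => (eV w).some)
    cE αE (fun e' f₀ p => (eE e' f₀ p).some) hT
    (fun e' f₀ p => Functor.isoWhiskerRight eψ.symm (ℋ.ρE e' ⋙ (αE e' f₀ p).inv) ≪≫
        Functor.isoWhiskerRight (ψ.reindexIso e' (ψ.base.edgeMap e') f₀ rfl p) (αE e' f₀ p).inv ≪≫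
        Functor.isoWhiskerLeft (𝒦.ρE f₀) (Functor.isoWhiskerRight (eE e' f₀ p).some (αE e' f₀ p).inv) ≪≫
        Functor.isoWhiskerLeft (𝒦.ρE f₀ ⋙ Over.star ((cE e' f₀ p).1 : 𝒦.E f₀))
          (αE e' f₀ p).asEquivalence.unitIso.symm)
    (fun _ _ _ => rfl) ?_ ?_ O ?_ hO OE ?_ hOE hφ'
  · intro w
    exact Hom.IsVertexAligned.localGlobalSection_mono ψ A αψ eψ w _ (αV w) (eV w).some hva (cV w).1.arrow
  · intro e' f₀ p
    exact Hom.sectionMapE_mono ψ A αψ eψ hψ hal hva e' f₀ p (cE e' f₀ p).1.arrow (αE e' f₀ p)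
      (eE e' f₀ p).some (hT e' f₀ p)
  · intro w
    exact Hom.localGlobalSection_factors ψ A αψ eψ w _ (αV w) (eV w).some (O w) ((hOc w (O w)).mp rfl)
  · intro e'
    obtain ⟨k, hk⟩ := Hom.nonempty_isoE_of_sectionMapE ψ A αψ eψ hψ hal hva e' _ (cE e' _ rfl).1.arrow
      (αE e' _ rfl) (eE e' _ rfl).some (hT e' _ rfl) (OE e') ((hOEc e' (OE e')).mp rfl)
    exact ⟨k.hom, hk⟩

/-- **[SemiAnbd] Remark 2.4.1 along finite étale coverings (F-1478), CONDITIONAL on the tie without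
connectedness hypotheses** (GAP-LEDGER G-w5d041-g4-1): if every locally-attached, branch- and
vertex-aligned covering with a global witness carries tie labels (clauses 1–4 of abc-iut-f-161's
`Hom.tie_bijective`, WITHOUT `ℋ.IsConnected` / `𝒦.IsConnected`), then `remark_2_4_1_covering` holds
(via abc-iut-w5-d041's `remark_2_4_1_covering_of_local_comp` and `comp_of_tieLabels`).
[cite: MochizukiSemiAnbd2006, Rem. 2.4.1 p.26] -/
theorem remark_2_4_1_covering_of_tie
    (htie : ∀ {ℋ 𝒦 : SemiGraphOfAnabelioids.{v₁, u₁, u}} (ψ : Hom ℋ 𝒦) (A : 𝒦.BObj)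
      [HasBinaryProducts 𝒦.BObj] (αψ : Over A ⥤ ℋ.BObj) [αψ.IsEquivalence]
      (eψ : ψ.pullbackFunctor ≅ Over.star A ⋙ αψ),
      ψ.IsFiniteEtaleCoveringOf A → ψ.IsBranchAligned → ψ.IsVertexAligned →
      ∃ (O : ∀ w : ℋ.graph.Vertex, π₀Obj (A.S (ψ.base.vertexMap w)))
        (OE : ∀ e' : ℋ.graph.Edge, π₀Obj (A.T (ψ.base.edgeMap e'))),
        Function.Bijective (fun w : ℋ.graph.Vertex =>
          (⟨ψ.base.vertexMap w, O w⟩ : Σ u, π₀Obj (A.S u))) ∧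
        Function.Bijective (fun e' : ℋ.graph.Edge =>
          (⟨ψ.base.edgeMap e', OE e'⟩ : Σ e, π₀Obj (A.T e))) ∧
        (∀ (w : ℋ.graph.Vertex) (P : π₀Obj (A.S (ψ.base.vertexMap w))),
          P = O w ↔ ∃ k : (αψ.obj (Over.mk (𝟙 A))).S w ⟶
              (ψ.φV w).pullback.obj (P.1 : 𝒦.V (ψ.base.vertexMap w)),
            k ≫ (ψ.φV w).pullback.map P.1.arrow =
              (αψ.map ((Over.forgetAdjStar A).unit.app (Over.mk (𝟙 A))) ≫ eψ.inv.app A).fS w) ∧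
        (∀ (e' : ℋ.graph.Edge) (Q : π₀Obj (A.T (ψ.base.edgeMap e'))),
          Q = OE e' ↔ ∃ k : (αψ.obj (Over.mk (𝟙 A))).T e' ⟶
              (ψ.φE e' (ψ.base.edgeMap e') rfl).pullback.obj (Q.1 : 𝒦.E (ψ.base.edgeMap e')),
            k ≫ (ψ.φE e' (ψ.base.edgeMap e') rfl).pullback.map Q.1.arrow =
              (αψ.map ((Over.forgetAdjStar A).unit.app (Over.mk (𝟙 A))) ≫ eψ.inv.app A).fT e')) :
    Literature.AnabelianGeometry.SemiGraphs.SemiGraphOfAnabelioids.remark_2_4_1_covering.{v₁, u₁, u} :=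
  remark_2_4_1_covering_of_local_comp
    fun _ φ _ A hψl _ _ _ hφl hφb hφv _ α _ e =>
      Hom.IsFiniteEtaleCoveringOf.comp_of_tieLabels hψl hφl hφb hφv α e (htie φ A α e hφl hφb hφv)

end SemiGraphOfAnabelioids

end Literature.AnabelianGeometry.SemiGraphs
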